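import Summits.CriticalPhenomena.PercolationContinuityZ3.Theorems.FK.InfiniteVolumeDefs
import HarnessLib

/-!
# FK-continuity transplant, FO-06 (construction half): local limits from increasing cylinders

Cell `fk-continuity` (bschramm), row FO-06 seat B; support file for the FK-continuity transplant
(`--supports stmt-CriticalPhenomena-4575`); builds on p205010 (kernel theorem, internal audit signed;
external expert review pending). No named facts, no sorries, standard axioms.

Generic measure theory on a configuration space `Set ι` (any index type `ι`), extracted from the
`d = 2` proof of Grimmett 2006, Thm. (4.19)(a) in the tree
(`Literature.Probability.Percolation.FKLoopNestingMeasureExistence`) so that the general-`d` files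
can use it: the cylinder events `cylEvent E₀ S = {ω | ω ∩ E₀ = S ∩ E₀}` (`InfiniteVolumeDefs.lean`)
are local and measurable; splitting a cylinder on one coordinate; and the packaging

* `tendsto_measureReal_cylEvent_of_supset`: if, along a sequence of finite measures, the
  probabilities of the INCREASING cylinders `{ω | E₀ ⊆ ω}` (`E₀` finite) converge, then the
  probabilities of all cylinders converge (inclusion–exclusion one coordinate at a time);
* `tendsto_measureReal_of_isLocalEvent_of_supset`: … and so do the probabilities of all local
  events (a local event is a finite disjoint union of cylinders);
* `exists_measure_tendsto_of_tendsto_supset`: hence, by the tree's Kolmogorov packaging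
  `exists_measure_tendsto_of_isLocalEvent` (`LocalLimitMeasure.lean`), a probability measure
  carrying the limits of all local-event probabilities exists;
* `isPiSystem_setOf_subset`, `generateFrom_setOf_subset`, `ext_of_setOf_subset`: the increasing
  cylinders `{E₀ ⊆ ω}` form a π-system generating the product σ-algebra, so they determine a
  probability measure ("convergence-determining", Grimmett 2006, proof of Thm. (4.19)); and
  `relabel_preimage_setOf_subset`: their transport under a relabelling of the coordinates.

## References

* G. Grimmett, *The Random-Cluster Model*, Springer 2006: §4.1 (cylinder σ-field), Thm. (4.19)(a)
  and its proof. [Grimmett2006]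
-/

noncomputable section

open MeasureTheory Set Filter
open scoped Topology ENNReal

namespace Summit.CriticalPhenomena.PercolationContinuityZ3.Theorems.FK

open Literature.Probability.Percolation Literature.Probability.LatticeModels

variable {ι : Type*}

/-! ### Cylinder events: locality, measurability, splitting -/

/-- A cylinder event is local (determined by `E₀`). [cite: Grimmett2006, §4.1] -/
theorem isLocalEvent_cylEvent (E₀ S : Finset ι) : IsLocalEvent (cylEvent E₀ S) := by
  refine ⟨E₀, (determinedBy_iff _ _).2 fun ω ω' h => ?_⟩
  simp only [mem_cylEvent_iff]
  refine forall₂_congr fun e he => ?_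
  have h1 := Set.ext_iff.1 h e
  simp only [Set.mem_inter_iff, Finset.mem_coe] at h1
  have : e ∈ ω ↔ e ∈ ω' := ⟨fun he' => (h1.1 ⟨he', he⟩).1, fun he' => (h1.2 ⟨he', he⟩).1⟩
  rw [this]

/-- A cylinder event is measurable. [cite: Grimmett2006, §4.1] -/
theorem measurableSet_cylEvent (E₀ S : Finset ι) : MeasurableSet (cylEvent E₀ S) :=
  measurableSet_of_isLocalEvent_holds (isLocalEvent_cylEvent E₀ S)

/-- With every prescribed coordinate present, the cylinder is the increasing event `{E₀ ⊆ ω}`.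
[folklore] -/
theorem cylEvent_eq_setOf_subset {E₀ S : Finset ι} (h : E₀ ⊆ S) :
    cylEvent E₀ S = {ω | (↑E₀ : Set ι) ⊆ ω} := by
  ext ω
  simp only [mem_cylEvent_iff, Set.mem_setOf_eq, Set.subset_def, Finset.mem_coe]
  exact forall₂_congr fun i hi => iff_true_right (h hi)

/-- The increasing cylinder `{E₀ ⊆ ω}` is a local event. [folklore] -/
theorem isLocalEvent_setOf_subset (E₀ : Finset ι) : IsLocalEvent {ω : Set ι | (↑E₀ : Set ι) ⊆ ω} := by
  rw [← cylEvent_eq_setOf_subset (Finset.Subset.refl E₀)]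
  exact isLocalEvent_cylEvent E₀ E₀

/-- The increasing cylinder `{E₀ ⊆ ω}` is measurable. [folklore] -/
theorem measurableSet_setOf_subset (E₀ : Finset ι) :
    MeasurableSet {ω : Set ι | (↑E₀ : Set ι) ⊆ ω} :=
  measurableSet_of_isLocalEvent_holds (isLocalEvent_setOf_subset E₀)


/-- Splitting a cylinder event on the state of one further coordinate `e₀ ∉ S`:
`C(E₀ ∖ {e₀}, S) = C(E₀, S) ∪ C(E₀, S ∪ {e₀})`. [folklore] -/
theorem cylEvent_erase_eq_union [DecidableEq ι] {E₀ S : Finset ι} {e₀ : ι} (he₀S : e₀ ∉ S) :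
    cylEvent (E₀.erase e₀) S = cylEvent E₀ S ∪ cylEvent E₀ (insert e₀ S) := by
  ext ω
  simp only [Set.mem_union, mem_cylEvent_iff, Finset.mem_erase, Finset.mem_insert]
  constructor
  · intro h
    by_cases hω : e₀ ∈ ω
    · refine Or.inr fun e he => ?_
      by_cases hee : e = e₀
      · subst hee
        exact ⟨fun _ => Or.inl rfl, fun _ => hω⟩
      · rw [h e ⟨hee, he⟩]
        exact ⟨fun hs => Or.inr hs, fun h' => h'.resolve_left hee⟩
    · refine Or.inl fun e he => ?_
      by_cases hee : e = e₀
      · subst hee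
        exact ⟨fun h' => absurd h' hω, fun h' => absurd h' he₀S⟩
      · exact h e ⟨hee, he⟩
  · rintro (h | h) e ⟨hne, he⟩
    · exact h e he
    · rw [h e he]
      exact ⟨fun h' => h'.resolve_left hne, fun hs => Or.inr hs⟩

/-- The two pieces of the splitting are disjoint. [folklore] -/
theorem disjoint_cylEvent_insert [DecidableEq ι] {E₀ S : Finset ι} {e₀ : ι} (he₀ : e₀ ∈ E₀)
    (he₀S : e₀ ∉ S) : Disjoint (cylEvent E₀ S) (cylEvent E₀ (insert e₀ S)) := by
  rw [Set.disjoint_left]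
  intro ω h h'
  rw [mem_cylEvent_iff] at h h'
  exact he₀S ((h e₀ he₀).1 ((h' e₀ he₀).2 (Finset.mem_insert_self e₀ S)))

/-- Cylinders over the same coordinates with different prescriptions are disjoint. [folklore] -/
theorem disjoint_cylEvent_of_ne {F S S' : Finset ι} (hS : S ⊆ F) (hS' : S' ⊆ F) (hne : S ≠ S') :
    Disjoint (cylEvent F S) (cylEvent F S') := by
  rw [Set.disjoint_left]
  intro ω h h'
  rw [mem_cylEvent_iff] at h h'
  apply hne
  ext e
  exact ⟨fun he => (h' e (hS he)).1 ((h e (hS he)).2 he),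
    fun he => (h e (hS' he)).1 ((h' e (hS' he)).2 he)⟩

/-! ### From increasing cylinders to all cylinders to all local events -/

/-- **Inclusion–exclusion, one coordinate at a time.** If, for a sequence of finite measures on
`Set ι`, the probabilities of the increasing cylinders `{E₀ ⊆ ω}` converge, then the probabilities
of all cylinder events converge. [cite: Grimmett2006, Thm. (4.19)(a), proof] -/
theorem tendsto_measureReal_cylEvent_of_supset (νs : ℕ → Measure (Set ι))
    [∀ n, IsFiniteMeasure (νs n)]
    (h : ∀ E₀ : Finset ι,
      ∃ r : ℝ, Tendsto (fun n => (νs n).real {ω | (↑E₀ : Set ι) ⊆ ω}) atTop (𝓝 r))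
    (E₀ S : Finset ι) :
    ∃ r : ℝ, Tendsto (fun n => (νs n).real (cylEvent E₀ S)) atTop (𝓝 r) := by
  classical
  -- induction on the number `|E₀ ∖ S|` of coordinates prescribed absent
  suffices H : ∀ k : ℕ, ∀ E₀ S : Finset ι, (E₀ \ S).card = k →
      ∃ r : ℝ, Tendsto (fun n => (νs n).real (cylEvent E₀ S)) atTop (𝓝 r) from
    H _ E₀ S rfl
  intro k
  induction k with
  | zero =>
    intro E₀ S hk
    rw [Finset.card_eq_zero, Finset.sdiff_eq_empty_iff_subset] at hk
    rw [cylEvent_eq_setOf_subset hk]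
    exact h E₀
  | succ k ih =>
    intro E₀ S hk
    obtain ⟨e₀, he₀⟩ : (E₀ \ S).Nonempty := by
      rw [← Finset.card_pos, hk]
      exact Nat.succ_pos k
    rw [Finset.mem_sdiff] at he₀
    obtain ⟨he₀E, he₀S⟩ := he₀
    have hk1 : (E₀.erase e₀ \ S).card = k := by
      rw [Finset.erase_sdiff_comm, Finset.card_erase_of_mem (Finset.mem_sdiff.2 ⟨he₀E, he₀S⟩), hk]
      rfl
    have hk2 : (E₀ \ insert e₀ S).card = k := by
      rw [Finset.sdiff_insert, Finset.card_erase_of_mem (Finset.mem_sdiff.2 ⟨he₀E, he₀S⟩), hk]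
      rfl
    obtain ⟨r₁, hr₁⟩ := ih (E₀.erase e₀) S hk1
    obtain ⟨r₂, hr₂⟩ := ih E₀ (insert e₀ S) hk2
    refine ⟨r₁ - r₂, ?_⟩
    have heq : ∀ n, (νs n).real (cylEvent E₀ S) =
        (νs n).real (cylEvent (E₀.erase e₀) S) - (νs n).real (cylEvent E₀ (insert e₀ S)) := by
      intro n
      rw [cylEvent_erase_eq_union he₀S,
        measureReal_union (disjoint_cylEvent_insert he₀E he₀S) (measurableSet_cylEvent _ _)]
      ring
    simp_rw [heq]
    exact hr₁.sub hr₂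

/-- **From cylinders to local events.** If the cylinder probabilities of a sequence of finite
measures converge, so do the probabilities of every local event: an event determined by the
finite set `F` is the disjoint union of the cylinders `C(F, S)`, `S ⊆ F`, it contains.
[cite: Grimmett2006, §4.1] -/
theorem tendsto_measureReal_of_isLocalEvent_of_cylEvent (νs : ℕ → Measure (Set ι))
    [∀ n, IsFiniteMeasure (νs n)]
    (h : ∀ E₀ S : Finset ι, ∃ r : ℝ, Tendsto (fun n => (νs n).real (cylEvent E₀ S)) atTop (𝓝 r))
    {A : Set (Set ι)} (hA : IsLocalEvent A) :
    ∃ r : ℝ, Tendsto (fun n => (νs n).real A) atTop (𝓝 r) := by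
  classical
  obtain ⟨F, hF⟩ := hA
  rw [determinedBy_iff] at hF
  set T : Finset (Finset ι) := F.powerset.filter fun S => ((S : Set ι) ∈ A) with hT
  -- decomposition of `A` into the cylinders it contains
  have hdec : A = ⋃ S ∈ T, cylEvent F S := by
    ext ω
    simp only [Set.mem_iUnion, hT, Finset.mem_filter, Finset.mem_powerset, exists_prop]
    constructor
    · intro hω
      refine ⟨F.filter (· ∈ ω), ⟨Finset.filter_subset _ _, ?_⟩, ?_⟩
      · refine (hF ω _ ?_).1 hω
        ext e
        simp only [Set.mem_inter_iff, Finset.mem_coe, Finset.coe_filter, Set.mem_setOf_eq]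
        tauto
      · rw [mem_cylEvent_iff]
        intro e he
        simp only [Finset.mem_filter]
        tauto
    · rintro ⟨S, ⟨-, hSA⟩, hω⟩
      rw [mem_cylEvent_iff] at hω
      refine (hF ω S ?_).2 hSA
      ext e
      simp only [Set.mem_inter_iff, Finset.mem_coe]
      exact ⟨fun h' => ⟨(hω e h'.2).1 h'.1, h'.2⟩, fun h' => ⟨(hω e h'.2).2 h'.1, h'.2⟩⟩
  have hdisj : (T : Set (Finset ι)).PairwiseDisjoint fun S => cylEvent F S := by
    intro S hS S' hS' hne
    have hSF : S ⊆ F := Finset.mem_powerset.1 (Finset.mem_filter.1 hS).1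
    have hS'F : S' ⊆ F := Finset.mem_powerset.1 (Finset.mem_filter.1 hS').1
    exact disjoint_cylEvent_of_ne hSF hS'F hne
  have hsum : ∀ n, (νs n).real A = ∑ S ∈ T, (νs n).real (cylEvent F S) := by
    intro n
    rw [hdec]
    exact measureReal_biUnion_finset hdisj fun S _ => measurableSet_cylEvent F S
  choose r hr using h
  refine ⟨∑ S ∈ T, r F S, ?_⟩
  simp_rw [hsum]
  exact tendsto_finsetSum _ fun S _ => hr F S

/-- Local events: convergence of the increasing cylinder probabilities implies convergence on
every local event. [cite: Grimmett2006, Thm. (4.19)(a), proof] -/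
theorem tendsto_measureReal_of_isLocalEvent_of_supset (νs : ℕ → Measure (Set ι))
    [∀ n, IsFiniteMeasure (νs n)]
    (h : ∀ E₀ : Finset ι,
      ∃ r : ℝ, Tendsto (fun n => (νs n).real {ω | (↑E₀ : Set ι) ⊆ ω}) atTop (𝓝 r))
    {A : Set (Set ι)} (hA : IsLocalEvent A) :
    ∃ r : ℝ, Tendsto (fun n => (νs n).real A) atTop (𝓝 r) :=
  tendsto_measureReal_of_isLocalEvent_of_cylEvent νs (tendsto_measureReal_cylEvent_of_supset νs h) hA

/-- **Local limit from increasing cylinders.** If `ν_n` are probability measures on `Set ι` whose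
probabilities of the increasing cylinders `{E₀ ⊆ ω}` (`E₀` finite) converge, there is a
probability measure `P` on `Set ι` with `ν_n(A) → P(A)` for every local event `A` (inclusion–
exclusion, then the tree's Kolmogorov packaging `exists_measure_tendsto_of_isLocalEvent`).
[cite: Grimmett2006, Thm. (4.19)(a), proof] -/
theorem exists_measure_tendsto_of_tendsto_supset (νs : ℕ → Measure (Set ι))
    [∀ n, IsProbabilityMeasure (νs n)]
    (h : ∀ E₀ : Finset ι,
      ∃ r : ℝ, Tendsto (fun n => (νs n).real {ω | (↑E₀ : Set ι) ⊆ ω}) atTop (𝓝 r)) :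
    ∃ P : Measure (Set ι), IsProbabilityMeasure P ∧
      ∀ A : Set (Set ι), IsLocalEvent A → Tendsto (fun n => νs n A) atTop (𝓝 (P A)) := by
  refine exists_measure_tendsto_of_isLocalEvent νs fun A hA => ?_
  obtain ⟨r, hr⟩ := tendsto_measureReal_of_isLocalEvent_of_supset νs h hA
  refine ⟨ENNReal.ofReal r, ?_⟩
  have : (fun n => νs n A) = fun n => ENNReal.ofReal ((νs n).real A) := by
    funext n
    rw [ofReal_measureReal]
  rw [this]
  exact ENNReal.tendsto_ofReal hr


/-! ### The increasing cylinders determine a probability measure -/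

/-- Two increasing cylinders intersect in the increasing cylinder of the union. [folklore] -/
theorem setOf_subset_inter_setOf_subset [DecidableEq ι] (E₀ E₁ : Finset ι) :
    ({ω : Set ι | (↑E₀ : Set ι) ⊆ ω} ∩ {ω | (↑E₁ : Set ι) ⊆ ω}) =
      {ω | (↑(E₀ ∪ E₁) : Set ι) ⊆ ω} := by
  ext ω
  simp only [Set.mem_inter_iff, Set.mem_setOf_eq, Finset.coe_union, Set.union_subset_iff]

/-- **The increasing cylinders `{E₀ ⊆ ω}` form a π-system.** [cite: Grimmett2006, §4.1] -/
theorem isPiSystem_setOf_subset :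
    IsPiSystem (Set.range fun E₀ : Finset ι => {ω : Set ι | (↑E₀ : Set ι) ⊆ ω}) := by
  classical
  rintro _ ⟨E₀, rfl⟩ _ ⟨E₁, rfl⟩ -
  exact ⟨E₀ ∪ E₁, (setOf_subset_inter_setOf_subset E₀ E₁).symm⟩

/-- A coordinate event is the increasing cylinder of a singleton. [folklore] -/
theorem setOf_mem_eq_setOf_singleton_subset (i : ι) :
    {ω : Set ι | i ∈ ω} = {ω | (↑({i} : Finset ι) : Set ι) ⊆ ω} := by
  ext ω
  simp only [Set.mem_setOf_eq, Finset.coe_singleton, Set.singleton_subset_iff]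

/-- **The increasing cylinders generate the product σ-algebra** on `Set ι`: the σ-algebra is
generated by the coordinate maps `ω ↦ [i ∈ ω]`, and each coordinate event is an increasing
cylinder or the complement of one. [cite: Grimmett2006, §4.1] -/
theorem generateFrom_setOf_subset :
    MeasurableSpace.generateFrom (Set.range fun E₀ : Finset ι => {ω : Set ι | (↑E₀ : Set ι) ⊆ ω}) =
      (Set.instMeasurableSpace : MeasurableSpace (Set ι)) := by
  refine le_antisymm (MeasurableSpace.generateFrom_le ?_) ?_
  · rintro _ ⟨E₀, rfl⟩
    exact measurableSet_setOf_subset E₀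
  · -- the product σ-algebra is generated by the coordinate projections
    have hpi : (Set.instMeasurableSpace : MeasurableSpace (Set ι)) =
        MeasurableSpace.generateFrom {B : Set (ι → Prop) |
          ∃ (i : ι) (A : Set Prop), MeasurableSet A ∧ Function.eval i ⁻¹' A = B} :=
      MeasurableSpace.pi_eq_generateFrom_projections (α := fun _ : ι => Prop)
    rw [hpi]
    refine MeasurableSpace.generateFrom_le fun B hB => ?_
    obtain ⟨i, A, -, rfl⟩ := hB
    have hi : MeasurableSet[MeasurableSpace.generateFrom
        (Set.range fun E₀ : Finset ι => {ω : Set ι | (↑E₀ : Set ι) ⊆ ω})] {ω : Set ι | i ∈ ω} := by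
      rw [setOf_mem_eq_setOf_singleton_subset]
      exact MeasurableSpace.measurableSet_generateFrom ⟨{i}, rfl⟩
    -- `eval i ⁻¹' A` is `{i ∈ ω} ∩ [True ∈ A] ∪ {i ∉ ω} ∩ [False ∈ A]`
    have hset : Function.eval i ⁻¹' A =
        ({ω : ι → Prop | ω i} ∩ {_ω | True ∈ A}) ∪ ({ω : ι → Prop | ω i}ᶜ ∩ {_ω | False ∈ A}) := by
      ext ω
      simp only [Set.mem_preimage, Function.eval, Set.mem_union, Set.mem_inter_iff,
        Set.mem_compl_iff, Set.mem_setOf_eq]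
      by_cases h : ω i
      · rw [eq_true h]
        tauto
      · rw [eq_false h]
        tauto
    rw [hset]
    have hi' : MeasurableSet[MeasurableSpace.generateFrom
        (Set.range fun E₀ : Finset ι => {ω : Set ι | (↑E₀ : Set ι) ⊆ ω})] {ω : ι → Prop | ω i} := hi
    exact (hi'.inter (MeasurableSet.const _)).union (hi'.compl.inter (MeasurableSet.const _))

/-- **The increasing cylinders determine a probability measure**: two probability measures on
`Set ι` giving every event `{E₀ ⊆ ω}` (`E₀` finite) the same mass are equal (Grimmett: "the
collection of all such events is convergence-determining"). [cite: Grimmett2006, Thm. (4.19), proof of (a)] -/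
theorem ext_of_setOf_subset {P P' : Measure (Set ι)} [IsProbabilityMeasure P]
    [IsProbabilityMeasure P']
    (h : ∀ E₀ : Finset ι, P {ω | (↑E₀ : Set ι) ⊆ ω} = P' {ω | (↑E₀ : Set ι) ⊆ ω}) : P = P' := by
  refine ext_of_generate_finite _ generateFrom_setOf_subset.symm isPiSystem_setOf_subset ?_
    (by rw [measure_univ, measure_univ])
  rintro _ ⟨E₀, rfl⟩
  exact h E₀

/-- Transport of an increasing cylinder under the relabelling of configurations by a bijection
`e2` of the coordinates (`ω ↦ e2 '' ω`): the increasing cylinder of the pulled-back set. [folklore] -/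
theorem relabel_preimage_setOf_subset {κ : Type*} (e2 : ι ≃ κ) (E₀ : Finset κ) :
    SiteConfig.relabel e2 ⁻¹' {ω : Set κ | (↑E₀ : Set κ) ⊆ ω} =
      {ω : Set ι | (↑(E₀.map e2.symm.toEmbedding) : Set ι) ⊆ ω} := by
  ext ω
  simp only [Set.mem_preimage, Set.mem_setOf_eq, Set.subset_def, Finset.mem_coe,
    SiteConfig.mem_relabel_iff, Finset.forall_mem_map, Equiv.coe_toEmbedding]

end Summit.CriticalPhenomena.PercolationContinuityZ3.Theorems.FK

end
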